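import Mathlib
import HarnessLib
import Literature.Analysis.Complex.ConeTubeIdentity

/-!
# Cross assembly, auxiliary file 1: gluing disc continuations into a strip, and the diagonal of a
# two-armed cross (sub-stub `stub_slabModeExpDecay_auxCrossAssembly` of line `self-energy-pick-inversion`)

Crux `PrecisionLaplacian.DirectCorrelationStableTail` (stmt-CriticalPhenomena-4799), parent stub
`stub_slabModeExpDecay` (the transverse mass gap), brick `stub_slabModeExpDecay_auxCrossAssembly`
(line holomorphy of the Green symbol function in the nine frames + the Bernstein–Siciak cross lemma
⇒ the G-side mass gap `HypG`).  This file contains the two abstract complex-analytic steps of the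
assembly; nothing here refers to the lattice model.

* `exists_differentiableOn_strip_of_balls` (registered as `stub_slabModeExpDecay_auxCrossAssembly2`):
  if a function `φ : ℝ → ℂ` has, around EVERY real point `θ`, a holomorphic continuation `Φ_θ` to
  the disc `B(θ, R)` (same radius for all `θ`), then `φ` is the trace of ONE function holomorphic on
  the strip `{|Im z| < R}`: neighbouring continuations agree on the (convex) intersection of their
  discs by the identity theorem from the real axis
  (`Literature.Analysis.Complex.eqOn_of_isPreconnected_of_eq_ofReal`), so `Ψ z := Φ_{Re z} z` is
  well defined and holomorphic.
* `exists_diagonal_extension_of_two_lines`: the elementary geometry of ONE application of the cross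
  lemma.  Given a real base point `P ∈ ℝ³`, two real directions `w₁, w₂`, and, for every real base
  point of the segments `P + [-1, 1] w₂` (resp. `P + [-1, 1] w₁`), a bounded holomorphic continuation
  of `t ↦ g(base + t w₁)` (resp. `t ↦ g(base + t w₂)`) to the disc `|t| < 2`, the function
  `f(t₀, t₁, t₂)` they define on the three-armed cross `X ⊂ ℂ³` (constant in the dummy variable
  `t₂`) is separately holomorphic and bounded, so the CROSS LEMMA (a hypothesis: Bernstein 1912,
  Siciak 1969; Jarnicki–Pflug, *First Steps in Several Complex Variables* / *Extension of
  holomorphic functions*, the classical cross theorem) continues it to the polydisc of radius `ρ`;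
  restricted to the complex diagonal `t ↦ (t, t, 0)` this is a holomorphic continuation of
  `t ↦ g(P + t (w₁ + w₂))` to the disc `|t| < min ρ 1`.
* small real-variable lemmas used by the frame geometry of the main file: distances to `2πℤ`
  (`le_abs_add_sub_two_pi_mul`), two coordinates control the sup norm, a coordinate realising the
  sup norm of `k ∈ ℝ²`.

Pure theorem file, no definitions, no `sorry`.  References: M. Jarnicki, P. Pflug, *Extension of
Holomorphic Functions* (2000), Ch. 5 [JarnickiPflug2011]; S. N. Bernstein (1912); J. Siciak,
Ann. Polon. Math. 22 (1969).
-/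

noncomputable section

namespace Summit.CriticalPhenomena.Ising3DConformalLimit.Cruxes.DirectCorrelationStableTail.SelfEnergyPickInversion

open MeasureTheory Filter Topology Complex Metric Set
open scoped BigOperators Real

/-! ### Gluing disc continuations along the real axis into a strip continuation -/

/-- **Gluing disc continuations.** If `φ : ℝ → ℂ` has around every real `θ` a holomorphic
continuation to the disc `B(θ, R)`, then `φ` is the real trace of a function holomorphic on the
strip `{|Im z| < R}` (identity theorem on the convex intersections of neighbouring discs).
[folklore] -/
theorem exists_differentiableOn_strip_of_balls {φ : ℝ → ℂ} {R : ℝ} (hR : 0 < R)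
    (h : ∀ θ : ℝ, ∃ Φ : ℂ → ℂ, DifferentiableOn ℂ Φ (ball (θ : ℂ) R) ∧
      ∀ s : ℝ, |s - θ| < R → Φ s = φ s) :
    ∃ Ψ : ℂ → ℂ, DifferentiableOn ℂ Ψ {z : ℂ | |z.im| < R} ∧ ∀ θ : ℝ, Ψ θ = φ θ := by
  choose Φ hΦd hΦt using h
  have hreal : ∀ (t θ : ℝ), (t : ℂ) ∈ ball (θ : ℂ) R → |t - θ| < R := fun t θ ht => by
    rwa [mem_ball, Complex.dist_eq, ← Complex.ofReal_sub, Complex.norm_real, Real.norm_eq_abs] at ht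
  -- neighbouring continuations agree on the intersection of their discs
  have hagree : ∀ (θ₁ θ₂ : ℝ) (z : ℂ), z ∈ ball (θ₁ : ℂ) R → z ∈ ball (θ₂ : ℂ) R →
      Φ θ₁ z = Φ θ₂ z := by
    intro θ₁ θ₂ z h₁ h₂
    set U : Set ℂ := ball (θ₁ : ℂ) R ∩ ball (θ₂ : ℂ) R with hU
    have hUo : IsOpen U := isOpen_ball.inter isOpen_ball
    have hUc : IsPreconnected U := ((convex_ball _ _).inter (convex_ball _ _)).isPreconnected
    have h12 : dist (θ₁ : ℂ) (θ₂ : ℂ) < R + R :=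
      (dist_triangle_left (θ₁ : ℂ) θ₂ z).trans_lt (add_lt_add h₁ h₂)
    have h12' : |θ₁ - θ₂| < R + R := by
      rwa [Complex.dist_eq, ← Complex.ofReal_sub, Complex.norm_real, Real.norm_eq_abs] at h12
    have hx : (((θ₁ + θ₂) / 2 : ℝ) : ℂ) ∈ U := by
      constructor
      · rw [mem_ball, Complex.dist_eq, ← Complex.ofReal_sub, Complex.norm_real, Real.norm_eq_abs,
          show (θ₁ + θ₂) / 2 - θ₁ = (θ₂ - θ₁) / 2 by ring, abs_div, abs_two, abs_sub_comm]
        linarith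
      · rw [mem_ball, Complex.dist_eq, ← Complex.ofReal_sub, Complex.norm_real, Real.norm_eq_abs,
          show (θ₁ + θ₂) / 2 - θ₂ = (θ₁ - θ₂) / 2 by ring, abs_div, abs_two]
        linarith
    refine Literature.Analysis.Complex.eqOn_of_isPreconnected_of_eq_ofReal hUo hUc hx
      ((hΦd θ₁).mono inter_subset_left) ((hΦd θ₂).mono inter_subset_right) (fun t ht => ?_)
      ⟨h₁, h₂⟩
    rw [hΦt θ₁ t (hreal t θ₁ ht.1), hΦt θ₂ t (hreal t θ₂ ht.2)]
  have himball : ∀ z : ℂ, |z.im| < R → z ∈ ball ((z.re : ℝ) : ℂ) R := fun z hz => by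
    have : z - (z.re : ℂ) = (z.im : ℂ) * I := by apply Complex.ext <;> simp
    rw [mem_ball, Complex.dist_eq, this, norm_mul, Complex.norm_I, mul_one, Complex.norm_real,
      Real.norm_eq_abs]
    exact hz
  refine ⟨fun z => Φ z.re z, ?_, ?_⟩
  · intro z₀ hz₀
    have hz₀' : z₀ ∈ ball ((z₀.re : ℝ) : ℂ) R := himball z₀ hz₀
    set V : Set ℂ := {z : ℂ | |z.im| < R} ∩ ball ((z₀.re : ℝ) : ℂ) R with hV
    have hVo : IsOpen V :=
      (isOpen_lt (continuous_abs.comp Complex.continuous_im) continuous_const).inter isOpen_ball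
    have hVn : V ∈ 𝓝 z₀ := hVo.mem_nhds ⟨hz₀, hz₀'⟩
    have heq : (fun z => Φ z.re z) =ᶠ[𝓝 z₀] Φ z₀.re :=
      Filter.eventually_of_mem hVn fun z hz => hagree z.re z₀.re z (himball z hz.1) hz.2
    refine ((heq.differentiableAt_iff).2 ?_).differentiableWithinAt
    exact (hΦd z₀.re).differentiableAt (isOpen_ball.mem_nhds hz₀')
  · intro θ
    show Φ (θ : ℂ).re θ = φ θ
    rw [ofReal_re]
    exact hΦt θ θ (by simpa using hR)

/-- **Registered auxiliary stub `stub_slabModeExpDecay_auxCrossAssembly2`** (brick of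
`stub_slabModeExpDecay`, cross-assembly part, gluing step): disc continuations of a common real
function around every real point, all of the same radius `R`, glue to a holomorphic function on the
strip `{|Im z| < R}` with that real trace (`exists_differentiableOn_strip_of_balls`). [folklore] -/
theorem stub_slabModeExpDecay_auxCrossAssembly2 : ∀ (φ : ℝ → ℂ) (R : ℝ), 0 < R →
    (∀ θ : ℝ, ∃ Φ : ℂ → ℂ, DifferentiableOn ℂ Φ (Metric.ball (θ : ℂ) R) ∧
      ∀ s : ℝ, |s - θ| < R → Φ s = φ s) →
    ∃ Ψ : ℂ → ℂ, DifferentiableOn ℂ Ψ {z : ℂ | |z.im| < R} ∧ ∀ θ : ℝ, Ψ θ = φ θ :=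
  fun _ _ hR h => exists_differentiableOn_strip_of_balls hR h

/-! ### The diagonal of a two-armed cross -/

/-- **One application of the cross lemma.** Let `g : ℝ³ → ℝ`, a base point `P`, directions
`w₁, w₂`, a bound `B`, and suppose: for every `|s| ≤ 1` the functions `t ↦ g(P + s w₂ + t w₁)` and
`t ↦ g(P + s w₁ + t w₂)` have holomorphic continuations to the disc `|t| < 2` bounded by `B`.  If
the cross lemma holds with the radius `ρ`, then `t ↦ g(P + t (w₁ + w₂))` has a holomorphic
continuation to the disc `|t| < min ρ 1` (the three-armed cross function is
`f(t₀, t₁, t₂) = F⁽¹⁾_{Re t₁}(t₀)` if `t₁ ∈ [-1, 1]`, else `F⁽²⁾_{Re t₀}(t₁)`, constant in `t₂`;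
restrict its extension to the diagonal `(t, t, 0)`). [folklore] -/
theorem exists_diagonal_extension_of_two_lines {g : (Fin 3 → ℝ) → ℝ} {P w₁ w₂ : Fin 3 → ℝ}
    {B ρ : ℝ} (hρ : 0 < ρ)
    (hCross : ∀ (f : (Fin 3 → ℂ) → ℂ) (M : ℝ), (∀ (j : Fin 3) (a : Fin 3 → ℝ), (∀ i, |a i| ≤ 1) →
      DifferentiableOn ℂ (fun z : ℂ => f (Function.update (fun i => ((a i : ℝ) : ℂ)) j z))
        (Metric.ball (0 : ℂ) 2)) →
      (∀ (j : Fin 3) (a : Fin 3 → ℝ) (z : ℂ), (∀ i, |a i| ≤ 1) → ‖z‖ < 2 →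
        ‖f (Function.update (fun i => ((a i : ℝ) : ℂ)) j z)‖ ≤ M) →
      ∃ g : (Fin 3 → ℂ) → ℂ, AnalyticOnNhd ℂ g {z | ∀ i, ‖z i‖ < ρ} ∧
        (∀ z : Fin 3 → ℂ, (∀ i, ‖z i‖ < ρ) → ‖g z‖ ≤ M) ∧
        ∀ (j : Fin 3) (a : Fin 3 → ℝ) (z : ℂ), (∀ i, |a i| ≤ 1) → ‖z‖ < 2 →
          (∀ i, ‖Function.update (fun i => ((a i : ℝ) : ℂ)) j z i‖ < ρ) →
          g (Function.update (fun i => ((a i : ℝ) : ℂ)) j z) =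
            f (Function.update (fun i => ((a i : ℝ) : ℂ)) j z))
    (h₁ : ∀ s : ℝ, |s| ≤ 1 → ∃ F : ℂ → ℂ, DifferentiableOn ℂ F (Metric.ball (0 : ℂ) 2) ∧
      (∀ t : ℝ, |t| < 2 → F t = (g (fun j => P j + s * w₂ j + t * w₁ j) : ℂ)) ∧
      ∀ z : ℂ, ‖z‖ < 2 → ‖F z‖ ≤ B)
    (h₂ : ∀ s : ℝ, |s| ≤ 1 → ∃ F : ℂ → ℂ, DifferentiableOn ℂ F (Metric.ball (0 : ℂ) 2) ∧
      (∀ t : ℝ, |t| < 2 → F t = (g (fun j => P j + s * w₁ j + t * w₂ j) : ℂ)) ∧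
      ∀ z : ℂ, ‖z‖ < 2 → ‖F z‖ ≤ B) :
    ∃ Φ : ℂ → ℂ, DifferentiableOn ℂ Φ (Metric.ball (0 : ℂ) (min ρ 1)) ∧
      ∀ t : ℝ, |t| < min ρ 1 → Φ t = (g (fun j => P j + t * (w₁ j + w₂ j)) : ℂ) := by
  choose! F₁ hF₁d hF₁t hF₁b using h₁
  choose! F₂ hF₂d hF₂t hF₂b using h₂
  classical
  -- the cross function
  set f : (Fin 3 → ℂ) → ℂ := fun t =>
    if (t 1).im = 0 ∧ |(t 1).re| ≤ 1 then F₁ (t 1).re (t 0) else F₂ (t 0).re (t 1) with hf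
  have hnorm : ∀ x : ℝ, |x| ≤ 1 → ‖(x : ℂ)‖ < 2 := fun x hx => by
    rw [Complex.norm_real, Real.norm_eq_abs]; linarith
  -- its values on the three arms
  have harm0 : ∀ a : Fin 3 → ℝ, (∀ i, |a i| ≤ 1) → ∀ z : ℂ,
      f (Function.update (fun i => ((a i : ℝ) : ℂ)) 0 z) = F₁ (a 1) z := by
    intro a ha z
    have h1 : Function.update (fun i => ((a i : ℝ) : ℂ)) 0 z 1 = (a 1 : ℂ) :=
      Function.update_of_ne (by decide) _ _
    simp only [hf, h1, Function.update_self, Complex.ofReal_im, Complex.ofReal_re, ha 1, and_self,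
      if_true]
  have harm1 : ∀ a : Fin 3 → ℝ, (∀ i, |a i| ≤ 1) → ∀ z : ℂ, ‖z‖ < 2 →
      f (Function.update (fun i => ((a i : ℝ) : ℂ)) 1 z) = F₂ (a 0) z := by
    intro a ha z hz
    have h0 : Function.update (fun i => ((a i : ℝ) : ℂ)) 1 z 0 = (a 0 : ℂ) :=
      Function.update_of_ne (by decide) _ _
    simp only [hf, h0, Function.update_self, Complex.ofReal_re]
    split_ifs with h
    · -- a real point of both arms: the two continuations agree with `g` there
      obtain ⟨hzi, hzr⟩ := h
      have hz' : z = ((z.re : ℝ) : ℂ) := by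
        apply Complex.ext <;> simp [hzi]
      have hzr2 : |z.re| < 2 := by linarith
      rw [hF₁t z.re hzr (a 0) (lt_of_le_of_lt (ha 0) one_lt_two), hz', Complex.ofReal_re,
        hF₂t (a 0) (ha 0) z.re hzr2]
      congr 2
      funext j
      ring
    · rfl
  have harm2 : ∀ a : Fin 3 → ℝ, (∀ i, |a i| ≤ 1) → ∀ z : ℂ,
      f (Function.update (fun i => ((a i : ℝ) : ℂ)) 2 z) = F₁ (a 1) (a 0) := by
    intro a ha z
    have h0 : Function.update (fun i => ((a i : ℝ) : ℂ)) 2 z 0 = (a 0 : ℂ) :=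
      Function.update_of_ne (by decide) _ _
    have h1 : Function.update (fun i => ((a i : ℝ) : ℂ)) 2 z 1 = (a 1 : ℂ) :=
      Function.update_of_ne (by decide) _ _
    simp only [hf, h0, h1, Complex.ofReal_im, Complex.ofReal_re, ha 1, and_self, if_true]
  -- separate holomorphy and the bound on the cross
  have hsep : ∀ (j : Fin 3) (a : Fin 3 → ℝ), (∀ i, |a i| ≤ 1) →
      DifferentiableOn ℂ (fun z : ℂ => f (Function.update (fun i => ((a i : ℝ) : ℂ)) j z))
        (Metric.ball (0 : ℂ) 2) := by
    intro j a ha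
    fin_cases j
    · exact (hF₁d (a 1) (ha 1)).congr fun z _ => harm0 a ha z
    · exact (hF₂d (a 0) (ha 0)).congr fun z hz => harm1 a ha z (mem_ball_zero_iff.mp hz)
    · exact (differentiableOn_const (F₁ (a 1) (a 0))).congr fun z _ => harm2 a ha z
  have hbd : ∀ (j : Fin 3) (a : Fin 3 → ℝ) (z : ℂ), (∀ i, |a i| ≤ 1) → ‖z‖ < 2 →
      ‖f (Function.update (fun i => ((a i : ℝ) : ℂ)) j z)‖ ≤ B := by
    intro j a z ha hz
    fin_cases j
    · simp only [Fin.zero_eta]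
      rw [harm0 a ha z]; exact hF₁b (a 1) (ha 1) z hz
    · simp only [Fin.mk_one]
      rw [harm1 a ha z hz]; exact hF₂b (a 0) (ha 0) z hz
    · simp only [Fin.reduceFinMk]
      rw [harm2 a ha z]; exact hF₁b (a 1) (ha 1) (a 0) (hnorm _ (ha 0))
  obtain ⟨G, hGa, -, hGf⟩ := hCross f B hsep hbd
  -- the complex diagonal `t ↦ (t, t, 0)` of the polydisc
  set e : ℂ → (Fin 3 → ℂ) := fun z j => if j = 2 then 0 else z with he
  have hed : Differentiable ℂ e := by
    refine differentiable_pi.mpr fun j => ?_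
    by_cases hj : j = 2
    · simp only [he, hj, if_true]; exact differentiable_const _
    · simp only [he, hj, if_false]; exact differentiable_id
  refine ⟨fun z => G (e z), ?_, ?_⟩
  · intro z hz
    have hzρ : ‖z‖ < ρ := (mem_ball_zero_iff.mp hz).trans_le (min_le_left _ _)
    have hmem : e z ∈ {w : Fin 3 → ℂ | ∀ i, ‖w i‖ < ρ} := fun i' => by
      by_cases hi' : i' = 2
      · simp only [he, hi', if_true, norm_zero]; exact hρ
      · simp only [he, hi', if_false]; exact hzρ
    exact ((hGa _ hmem).differentiableAt.comp z (hed z)).differentiableWithinAt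
  · intro t ht
    have ht1 : |t| < 1 := ht.trans_le (min_le_right _ _)
    have htρ : |t| < ρ := ht.trans_le (min_le_left _ _)
    set a : Fin 3 → ℝ := fun j => if j = 2 then 0 else t with ha
    have ha1 : ∀ i, |a i| ≤ 1 := fun i' => by
      by_cases hi' : i' = 2
      · simp only [ha, hi', if_true, abs_zero]; exact zero_le_one
      · simp only [ha, hi', if_false]; exact ht1.le
    have hea : e t = Function.update (fun i => ((a i : ℝ) : ℂ)) 0 (t : ℂ) := by
      funext j
      fin_cases j
      · simp [he, ha]
      · simp [he, ha]
      · simp [he, ha]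
    have hcoord : ∀ i, ‖Function.update (fun i => ((a i : ℝ) : ℂ)) 0 (t : ℂ) i‖ < ρ := by
      intro i'
      rw [← hea]
      by_cases hi' : i' = 2
      · simp only [he, hi', if_true, norm_zero]; exact hρ
      · simp only [he, hi', if_false, Complex.norm_real, Real.norm_eq_abs]; exact htρ
    show G (e t) = _
    rw [hea, hGf 0 a t ha1 (hnorm t ht1.le) hcoord, harm0 a ha1,
      hF₁t (a 1) (ha1 1) t (by linarith)]
    have : a 1 = t := by simp [ha]
    rw [this]
    congr 2
    funext j
    ring

/-! ### Elementary real-variable lemmas for the frame geometry -/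

/-- **Distance to `2πℤ` from one fundamental domain.** If `δ ≤ |y| ≤ 2π - δ`, then every point
`y + 2πn₀` is at distance `≥ δ` from `2πℤ`. [folklore] -/
theorem le_abs_add_sub_two_pi_mul {y δ : ℝ} (n₀ : ℤ) (h₁ : δ ≤ |y|) (h₂ : |y| ≤ 2 * Real.pi - δ)
    (n : ℤ) : δ ≤ |y + 2 * Real.pi * n₀ - 2 * Real.pi * n| := by
  by_cases hn : n = n₀
  · subst hn
    simpa using h₁
  · have h1 : (1 : ℝ) ≤ |((n : ℝ) - n₀)| := by
      have := Int.one_le_abs (sub_ne_zero.mpr hn)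
      exact_mod_cast this
    have h2 : 2 * Real.pi ≤ |2 * Real.pi * ((n : ℝ) - n₀)| := by
      rw [abs_mul, abs_of_pos Real.two_pi_pos]
      nlinarith [Real.pi_pos]
    have h3 : |2 * Real.pi * ((n : ℝ) - n₀)| - |y| ≤ |y + 2 * Real.pi * n₀ - 2 * Real.pi * n| := by
      have := abs_sub_abs_le_abs_sub (2 * Real.pi * ((n : ℝ) - n₀)) y
      calc |2 * Real.pi * ((n : ℝ) - n₀)| - |y| ≤ |2 * Real.pi * ((n : ℝ) - n₀) - y| := this
        _ = |y + 2 * Real.pi * n₀ - 2 * Real.pi * n| := by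
          rw [abs_sub_comm]; congr 1; ring
    linarith

/-- Two coordinates control the sup norm: `|vᵢ - vₐ| ≤ 2‖v‖_∞`. [folklore] -/
theorem abs_sub_le_two_mul_norm (v : Fin 3 → ℝ) (i a : Fin 3) : |v i - v a| ≤ 2 * ‖v‖ := by
  have hi : |v i| ≤ ‖v‖ := by simpa [Real.norm_eq_abs] using norm_le_pi_norm v i
  have ha : |v a| ≤ ‖v‖ := by simpa [Real.norm_eq_abs] using norm_le_pi_norm v a
  calc |v i - v a| ≤ |v i| + |v a| := abs_sub _ _
    _ ≤ 2 * ‖v‖ := by linarith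

/-- Two coordinates control the sup norm: `|vᵢ + vₐ| ≤ 2‖v‖_∞`. [folklore] -/
theorem abs_add_le_two_mul_norm (v : Fin 3 → ℝ) (i a : Fin 3) : |v i + v a| ≤ 2 * ‖v‖ := by
  have hi : |v i| ≤ ‖v‖ := by simpa [Real.norm_eq_abs] using norm_le_pi_norm v i
  have ha : |v a| ≤ ‖v‖ := by simpa [Real.norm_eq_abs] using norm_le_pi_norm v a
  calc |v i + v a| ≤ |v i| + |v a| := abs_add_le _ _
    _ ≤ 2 * ‖v‖ := by linarith

/-- A coordinate realising the sup norm of a nonzero `k ∈ ℝ²`. [folklore] -/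
theorem exists_norm_le_abs (k : Fin 2 → ℝ) (hK : 0 < ‖k‖) : ∃ j, ‖k‖ ≤ |k j| := by
  by_contra h
  simp only [not_exists, not_le] at h
  have := (pi_norm_lt_iff hK).mpr fun j => by rw [Real.norm_eq_abs]; exact h j
  exact lt_irrefl _ this

/-- A reduced transverse momentum is far from the lattice in its largest coordinate:
`‖k‖ ≤ |k_a - 2πn|` for all `n ∈ ℤ` when `|k_a| = ‖k‖_∞` and `|k_j| < π`. [folklore] -/
theorem norm_le_abs_sub_two_pi_mul {k : Fin 2 → ℝ} (hk : ∀ j, |k j| < Real.pi) {a : Fin 2}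
    (ha : ‖k‖ ≤ |k a|) (n : ℤ) : ‖k‖ ≤ |k a - 2 * Real.pi * n| := by
  have := le_abs_add_sub_two_pi_mul (y := k a) (δ := ‖k‖) 0 ha
    (by linarith [hk a, Real.pi_pos, norm_nonneg k]) n
  simpa using this

/-- **The decisive distance estimate of Case B.** If `|θ - 2πn₀| < K/4`, `|κ| = K ≤ π` and
`|x| ≤ K/4`, then `θ + κ + x` is at distance `≥ K/2` from `2πℤ`. [folklore] -/
theorem half_le_abs_of_near {θ κ K x : ℝ} {n₀ : ℤ} (hθ : |θ - 2 * Real.pi * n₀| < K / 4)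
    (hκ : |κ| = K) (hKπ : K ≤ Real.pi) (hx : |x| ≤ K / 4) (n : ℤ) :
    K / 2 ≤ |θ + κ + x - 2 * Real.pi * n| := by
  have hy1 : K / 2 ≤ |θ - 2 * Real.pi * n₀ + κ + x| := by
    have h := abs_add_le (θ - 2 * Real.pi * n₀ + κ + x) (-(θ - 2 * Real.pi * n₀) - x)
    have h' : |(-(θ - 2 * Real.pi * n₀) - x)| ≤ K / 4 + K / 4 := by
      calc |(-(θ - 2 * Real.pi * n₀) - x)| ≤ |(-(θ - 2 * Real.pi * n₀))| + |x| := abs_sub _ _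
        _ ≤ K / 4 + K / 4 := by rw [abs_neg]; linarith [hθ.le]
    have h'' : θ - 2 * Real.pi * n₀ + κ + x + (-(θ - 2 * Real.pi * n₀) - x) = κ := by ring
    rw [h'', hκ] at h
    linarith
  have hy2 : |θ - 2 * Real.pi * n₀ + κ + x| ≤ 2 * Real.pi - K / 2 := by
    calc |θ - 2 * Real.pi * n₀ + κ + x|
        ≤ |θ - 2 * Real.pi * n₀ + κ| + |x| := abs_add_le _ _
      _ ≤ |θ - 2 * Real.pi * n₀| + |κ| + |x| := by
          linarith [abs_add_le (θ - 2 * Real.pi * n₀) κ]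
      _ ≤ 2 * Real.pi - K / 2 := by rw [hκ]; linarith [hθ.le]
  have := le_abs_add_sub_two_pi_mul n₀ hy1 hy2 n
  have h'' : θ - 2 * Real.pi * n₀ + κ + x + 2 * Real.pi * n₀ - 2 * Real.pi * n =
      θ + κ + x - 2 * Real.pi * n := by ring
  rwa [h''] at this

end Summit.CriticalPhenomena.Ising3DConformalLimit.Cruxes.DirectCorrelationStableTail.SelfEnergyPickInversion

end
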